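import Summits.BirchSwinnertonDyer.BirchSwinnertonDyer.Theorems.AlignedTransportAtTwoMainConjectureOfRankZeroBSDAtTwoSelmerLayerDuality
import Literature.NumberTheory.EllipticCurves.Greenberg1999.MordellWeilRankLayerBoundProofs
import HarnessLib

/-!
# Route `AlignedTransportAtTwo`, crux C2 `MainConjectureOfRankZeroBSDAtTwo` (stmt-BirchSwinnertonDyer-22298):
# MAZUR'S CONTROL THEOREM IN CORANK FORM AT EVERY LAYER —
# `corank_{ℤ_p} Sel_{p^∞}(E_{K_n}/K_n) ≤ rank_{ℤ_p} X/ω_n X` (Lemma 3.1, unconditional) and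
# `=` as soon as Greenberg's `ker g_n` (equivalently `coker s_n`) is finite

HONEST FRAMING (cell `bsd-f1-sign2`, WIDTH-5 attached prover seat `bsd-line-att-p5` gen 40 on line `birth` of the lead
`bsd-line-att-p2`; `--supports` stmt-BirchSwinnertonDyer-22298, closes nothing; BSD is NOT proved by any of this; the crux
C2, its verdict «blocked-on `Rank1Residual.GreenbergMuConjectureIrreducible`» and every registered stub are untouched).
THEOREMS ONLY — no `def`, no instance, no named fact, no `sorry`. Second half of the lineage's LAYER-`n` CORANK CONTROL
(first half `…SelmerLayerDuality`: `corank Sel_∞^{Γ_n} = rank_{ℤ_p} X/ω_n X` unconditionally). The tree proves Mazur's control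
theorem in corank form AT THE BASE LAYER ONLY (`finite_and_coinvariantsRank_eq_selmerCorank_of_finite_coker`; over `ℚ` at a good
ordinary `p` unconditionally, `Greenberg1999_coinvariantsRank_eq_selmerCorank_rat_holds`). Here, for EVERY number field `K`, EVERY
`ℤ_p`-extension `κ` with topological generator `γ`, EVERY Pontryagin-dual datum `D` with `X = D.X` finitely generated, every `n`
(`Sel_n = W.selmerLayer κ n`, `s_n = W.sMap κ n`, `ker g_n = W.KerG κ n`, `coker s_n = W.CokerS κ n` of `IwasawaSelmerControl…`):

* ★★ `zpCorank_selmerLayer_le_lambdaInvariant_layerQuotient` — **`corank Sel_n ≤ rank_{ℤ_p} X/ω_n X`** (Lemma 3.1,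
  `finite_ker_layerToInfty`, NO reduction hypothesis);
* ★★★ `zpCorank_selmerLayer_eq_lambdaInvariant_layerQuotient_of_finite_cokerS` / `…_of_finite_kerG` — **equality when
  `coker s_n` (resp. Greenberg's `ker g_n = A_n/Sel_n`) is finite** (`coker h_n = 0` for every `ℤ_p`-extension:
  `kerGToCoker_surjective`);
* in the currency of the honest Selmer group of the layer NUMBER FIELD `K_n` (g39's model identification
  `selmerCorank_layer_eq_zpCorank_selmerLayer`): ★★★ `selmerCorank_layer_eq_lambdaInvariant_layerQuotient_of_finite_kerG` —
  **`corank_{ℤ_p} Sel_{p^∞}(E_{K_n}/K_n) = rank_{ℤ_p} X/ω_n X`**; `selmerCorank_layer_le_lambdaInvariant_layerQuotient`;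
  `…_of_isCyclotomic` (no finite-generation hypothesis for the cyclotomic tower).

What this does NOT do: prove `Finite (W.KerG κ n)` for `n ≥ 1` — over `ℚ` that is exactly Greenberg's Lemma 3.4 at the layer `n`
(the tree's named fact `Greenberg1999.lemma34_natCard_localTowerKerPrimary_eq_rat`; `selmer_control_of_lemma34`).

References: R. Greenberg, LNM 1716 (1999), Thm. 1.2 (pp. 59–60), §1 pp. 60, 65, §3 Lemmas 3.1–3.2 (p. 86), 3.5 (p. 90), 4.3
(p. 103) [GreenbergLNM1716]; B. Mazur, Invent. Math. 18 (1972), §6 [Mazur1972].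
-/

set_option linter.dupNamespace false
set_option autoImplicit false

noncomputable section

open scoped Classical AddSubgroup TensorProduct

universe u

namespace Summit.BirchSwinnertonDyer.BirchSwinnertonDyer.Theorems.AlignedTransportAtTwoSelmerLayerControl

open WeierstrassCurve Literature.NumberTheory.EllipticCurves Literature.NumberTheory.EllipticCurves.IwasawaDual
  Summit.BirchSwinnertonDyer.BirchSwinnertonDyer.Theorems.AlignedTransportAtTwoSelmerLayerModel
  Summit.BirchSwinnertonDyer.BirchSwinnertonDyer.Theorems.AlignedTransportAtTwoSelmerLayerDuality

/-! ## §3 Control in corank form at layer `n` -/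

section Control

variable {K : Type u} [Field K] [NumberField K] (W : WeierstrassCurve K) [W.IsElliptic] {p : ℕ} [Fact p.Prime]
  (κ : ZpExtension K p) {γ : Field.absoluteGaloisGroup K}

omit [W.IsElliptic] in
/-- `Sel_∞^{Γ_n}` has finite `p`-torsion when `X` is finitely generated (plumbing for the corank formula).
[cite: GreenbergLNM1716, §1 p. 60] -/
theorem finite_torsionBy_selmerInvariants (hγ : κ.IsTopGenerator γ) (D : W.SelmerDualData κ γ)
    [Module.Finite (IwasawaAlgebra p) D.X] (n : ℕ) :
    Finite (↥(W.selmerInfty κ ⊓ W.layerInvariants κ n))[(p : ℤ)] := by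
  obtain ⟨Ψ, -⟩ := exists_addEquiv_layerQuotient_characterModule_selmerInvariants p W κ hγ D n
  letI : Module ℤ_[p] (D.X ⧸ (Ideal.span {((1 + PowerSeries.X : PowerSeries ℤ_[p]) ^ (p ^ n) - 1 : IwasawaAlgebra p)} •
      ⊤ : Submodule (IwasawaAlgebra p) D.X)) := Module.compHom _ (algebraMap ℤ_[p] (IwasawaAlgebra p))
  haveI : Module.Finite ℤ_[p] (D.X ⧸ (Ideal.span {((1 + PowerSeries.X : PowerSeries ℤ_[p]) ^ (p ^ n) - 1 :
      IwasawaAlgebra p)} • ⊤ : Submodule (IwasawaAlgebra p) D.X)) :=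
    module_finite_int_quotient p (X := D.X) _ (module_finite_int_quotient_omega p n)
  exact finite_torsionBy_of_addEquiv_characterModule p Ψ

/-- ★★ **`corank_{ℤ_p} Sel_n ≤ rank_{ℤ_p} X/ω_n X` unconditionally** (`Sel_n = W.selmerLayer κ n`, any number field, any
`ℤ_p`-extension with topological generator, `X` finitely generated): the control map `s_n : Sel_n → Sel_∞^{Γ_n}`
(`W.sMap κ n`) has finite kernel by Greenberg's Lemma 3.1 (`finite_ker_layerToInfty`, `ker s_n ⊆ ker h_n`), so
`corank Sel_n ≤ corank Sel_∞^{Γ_n}` (`zpCorank_le_of_finite_ker`) `= rank X/ω_n X` (§2).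
[cite: GreenbergLNM1716, §3 Lemma 3.1 (p. 86) and §1 p. 65] -/
theorem zpCorank_selmerLayer_le_lambdaInvariant_layerQuotient (hγ : κ.IsTopGenerator γ) (D : W.SelmerDualData κ γ)
    [Module.Finite (IwasawaAlgebra p) D.X] (n : ℕ) :
    zpCorank (W.selmerLayer κ n) p ≤
      lambdaInvariant p (D.X ⧸ (Ideal.span {((1 + PowerSeries.X : PowerSeries ℤ_[p]) ^ (p ^ n) - 1 : IwasawaAlgebra p)} •
        ⊤ : Submodule (IwasawaAlgebra p) D.X)) := by
  rw [← zpCorank_selmerInvariants_eq_lambdaInvariant_layerQuotient p W κ hγ D n]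
  haveI := finite_torsionBy_selmerInvariants W κ hγ D n
  haveI : Finite (W.selmerLayer κ n)[(p : ℤ)] :=
    W.finite_torsionBy_selmerGroupOver p (κ.layerSubgroup n) (κ.isOpen_layerSubgroup n)
  haveI : Finite (W.layerToInfty κ n).ker := W.finite_ker_layerToInfty hγ n
  haveI : Finite (W.sMap κ n).ker := by
    refine Finite.of_injective (fun y : (W.sMap κ n).ker ↦
      (⟨((y : W.selmerLayer κ n) : W.subgroupH1 p (κ.layerSubgroup n)), ?_⟩ : (W.layerToInfty κ n).ker)) ?_
    · have hy : W.sMap κ n (y : W.selmerLayer κ n) = 0 := y.2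
      rw [AddMonoidHom.mem_ker, ← coe_sMap_apply, hy]
      rfl
    · intro a b hab
      exact Subtype.ext (Subtype.ext (by simpa using congrArg Subtype.val hab))
  have hA : ∀ a : ↥(W.selmerInfty κ ⊓ W.layerInvariants κ n), ∃ k : ℕ, p ^ k • a = 0 := fun a ↦ by
    obtain ⟨k, hk⟩ := W.exists_pow_smul_subgroupH1_ker_eq_zero κ (a : W.subgroupH1 p κ.kerSubgroup)
    exact ⟨k, Subtype.ext (by rw [AddSubgroupClass.coe_nsmul, hk]; rfl)⟩
  -- `corank Sel_n = corank (im s_n) ≤ corank Sel_∞^{Γ_n}`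
  set F := W.sMap κ n with hF
  have h1 : zpCorank (W.selmerLayer κ n) p = zpCorank F.range p :=
    zpCorank_eq_of_shortExact_of_finite_left (i := F.ker.subtype) (f := F.rangeRestrict)
      Subtype.val_injective F.rangeRestrict_surjective
      (fun a ha ↦ ⟨⟨a, by simpa using congrArg (fun z : F.range ↦ (z : ↥(W.selmerInfty κ ⊓ W.layerInvariants κ n))) ha⟩,
        rfl⟩)
      (fun a ↦ Subtype.ext a.2) (exists_pow_smul_selmerLayer_eq_zero W κ n)
  have h2 : zpCorank ↥(W.selmerInfty κ ⊓ W.layerInvariants κ n) p =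
      zpCorank F.range p + zpCorank (↥(W.selmerInfty κ ⊓ W.layerInvariants κ n) ⧸ F.range) p :=
    zpCorank_eq_add_of_shortExact (i := F.range.subtype) (f := QuotientAddGroup.mk' F.range)
      Subtype.val_injective (QuotientAddGroup.mk'_surjective _)
      (fun b hb ↦ ⟨⟨b, (QuotientAddGroup.eq_zero_iff b).mp hb⟩, rfl⟩)
      (fun a ↦ (QuotientAddGroup.eq_zero_iff _).mpr a.2) hA
  omega

/-- ★★★ **Control in corank form at layer `n`: `corank_{ℤ_p} Sel_n = rank_{ℤ_p} X/ω_n X` as soon as `coker s_n` is finite**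
(`W.CokerS κ n`; any number field, any `ℤ_p`-extension with topological generator, `X` finitely generated): `s_n` has finite
kernel (Lemma 3.1) and finite cokernel, so `corank Sel_n = corank Sel_∞^{Γ_n}` (`zpCorank_eq_of_finite_ker_of_finite_coker`,
`range_sMap_eq`) `= rank X/ω_n X` (§2). The layer-`0` case is the tree's
`finite_and_coinvariantsRank_eq_selmerCorank_of_finite_coker`. [cite: GreenbergLNM1716, Thm 1.2 and §1 pp. 60, 65] -/
theorem zpCorank_selmerLayer_eq_lambdaInvariant_layerQuotient_of_finite_cokerS (hγ : κ.IsTopGenerator γ)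
    (D : W.SelmerDualData κ γ) [Module.Finite (IwasawaAlgebra p) D.X] (n : ℕ) [Finite (W.CokerS κ n)] :
    zpCorank (W.selmerLayer κ n) p =
      lambdaInvariant p (D.X ⧸ (Ideal.span {((1 + PowerSeries.X : PowerSeries ℤ_[p]) ^ (p ^ n) - 1 : IwasawaAlgebra p)} •
        ⊤ : Submodule (IwasawaAlgebra p) D.X)) := by
  rw [← zpCorank_selmerInvariants_eq_lambdaInvariant_layerQuotient p W κ hγ D n]
  haveI := finite_torsionBy_selmerInvariants W κ hγ D n
  haveI : Finite (W.selmerLayer κ n)[(p : ℤ)] :=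
    W.finite_torsionBy_selmerGroupOver p (κ.layerSubgroup n) (κ.isOpen_layerSubgroup n)
  haveI : Finite (W.layerToInfty κ n).ker := W.finite_ker_layerToInfty hγ n
  haveI : Finite (W.sMap κ n).ker := by
    refine Finite.of_injective (fun y : (W.sMap κ n).ker ↦
      (⟨((y : W.selmerLayer κ n) : W.subgroupH1 p (κ.layerSubgroup n)), ?_⟩ : (W.layerToInfty κ n).ker)) ?_
    · have hy : W.sMap κ n (y : W.selmerLayer κ n) = 0 := y.2
      rw [AddMonoidHom.mem_ker, ← coe_sMap_apply, hy]
      rfl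
    · intro a b hab
      exact Subtype.ext (Subtype.ext (by simpa using congrArg Subtype.val hab))
  haveI : Finite (↥(W.selmerInfty κ ⊓ W.layerInvariants κ n) ⧸ (W.sMap κ n).range) := by
    rw [range_sMap_eq]; infer_instance
  exact zpCorank_eq_of_finite_ker_of_finite_coker (W.sMap κ n) (exists_pow_smul_selmerLayer_eq_zero W κ n)
    (fun a ↦ by
      obtain ⟨k, hk⟩ := W.exists_pow_smul_subgroupH1_ker_eq_zero κ (a : W.subgroupH1 p κ.kerSubgroup)
      exact ⟨k, Subtype.ext (by rw [AddSubgroupClass.coe_nsmul, hk]; rfl)⟩)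

omit [W.IsElliptic] in
/-- **`ker g_n` finite ⟹ `coker s_n` finite** (`coker h_n = 0` for EVERY `ℤ_p`-extension: the snake map
`ker g_n → coker s_n` is onto, `kerGToCoker_surjective`). [cite: GreenbergLNM1716, §3 Lemma 3.2 (p. 86) and p. 90] -/
theorem finite_cokerS_of_finite_kerG (n : ℕ) [Finite (W.KerG κ n)] : Finite (W.CokerS κ n) :=
  Finite.of_surjective _ (W.kerGToCoker_surjective κ n)

/-- ★★★ **`corank_{ℤ_p} Sel_n = rank_{ℤ_p} X/ω_n X` as soon as Greenberg's `ker g_n = A_n/Sel_n` is finite** — the form in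
which the remaining input is LOCAL (Lemma 3.5 at the single layer `n`: the local tower kernels `𝒦_{v,n}[p^∞]`; over `ℚ`,
Lemma 3.4 at layer `n`). [cite: GreenbergLNM1716, Thm 1.2, §3 Lemma 3.5 (p. 90)] -/
theorem zpCorank_selmerLayer_eq_lambdaInvariant_layerQuotient_of_finite_kerG (hγ : κ.IsTopGenerator γ)
    (D : W.SelmerDualData κ γ) [Module.Finite (IwasawaAlgebra p) D.X] (n : ℕ) [Finite (W.KerG κ n)] :
    zpCorank (W.selmerLayer κ n) p =
      lambdaInvariant p (D.X ⧸ (Ideal.span {((1 + PowerSeries.X : PowerSeries ℤ_[p]) ^ (p ^ n) - 1 : IwasawaAlgebra p)} •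
        ⊤ : Submodule (IwasawaAlgebra p) D.X)) := by
  haveI := finite_cokerS_of_finite_kerG W κ n
  exact zpCorank_selmerLayer_eq_lambdaInvariant_layerQuotient_of_finite_cokerS W κ hγ D n

/-- ★★★ **`corank_{ℤ_p} Sel_{p^∞}(E_{K_n}/K_n) = rank_{ℤ_p} X/ω_n X` when `ker g_n` is finite** — the honest Selmer group of the
base change to the layer number field `K_n` (file `Selmer`), through g39's model identification
`selmerCorank_layer_eq_zpCorank_selmerLayer`. [cite: GreenbergLNM1716, Thm 1.2 and §1 p. 65] -/
theorem selmerCorank_layer_eq_lambdaInvariant_layerQuotient_of_finite_kerG (hγ : κ.IsTopGenerator γ)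
    (D : W.SelmerDualData κ γ) [Module.Finite (IwasawaAlgebra p) D.X] (n : ℕ) [Finite (W.KerG κ n)] :
    (W.baseChange (κ.layer n)).selmerCorank p =
      lambdaInvariant p (D.X ⧸ (Ideal.span {((1 + PowerSeries.X : PowerSeries ℤ_[p]) ^ (p ^ n) - 1 : IwasawaAlgebra p)} •
        ⊤ : Submodule (IwasawaAlgebra p) D.X)) := by
  rw [selmerCorank_layer_eq_zpCorank_selmerLayer W κ n]
  exact zpCorank_selmerLayer_eq_lambdaInvariant_layerQuotient_of_finite_kerG W κ hγ D n

/-- ★★ **`corank_{ℤ_p} Sel_{p^∞}(E_{K_n}/K_n) ≤ rank_{ℤ_p} X/ω_n X` unconditionally** (Lemma 3.1 only; sharper than Greenberg's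
Thm. 1.9 bound `≤ λ(X)` of `…SelmerLayerLambdaBound` in that it sees only the `ω_n`-part of `X`).
[cite: GreenbergLNM1716, §3 Lemma 3.1 (p. 86), Thm 1.9 (p. 63)] -/
theorem selmerCorank_layer_le_lambdaInvariant_layerQuotient (hγ : κ.IsTopGenerator γ) (D : W.SelmerDualData κ γ)
    [Module.Finite (IwasawaAlgebra p) D.X] (n : ℕ) :
    (W.baseChange (κ.layer n)).selmerCorank p ≤
      lambdaInvariant p (D.X ⧸ (Ideal.span {((1 + PowerSeries.X : PowerSeries ℤ_[p]) ^ (p ^ n) - 1 : IwasawaAlgebra p)} •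
        ⊤ : Submodule (IwasawaAlgebra p) D.X)) := by
  rw [selmerCorank_layer_eq_zpCorank_selmerLayer W κ n]
  exact zpCorank_selmerLayer_le_lambdaInvariant_layerQuotient W κ hγ D n

/-- The cyclotomic case needs no finite-generation hypothesis (`X(E/K_∞^{cyc})` is finitely generated over `Λ`,
`SelmerDualData.module_finite_of_isCyclotomic`): **`corank_{ℤ_p} Sel_{p^∞}(E_{K_n}/K_n) ≤ rank_{ℤ_p} X/ω_n X`**, with equality
when `ker g_n` is finite. [cite: GreenbergLNM1716, Thm 1.2, §1 p. 60 and §3] -/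
theorem selmerCorank_layer_le_lambdaInvariant_layerQuotient_of_isCyclotomic (hκ : κ.IsCyclotomic) (hγ : κ.IsTopGenerator γ)
    (D : W.SelmerDualData κ γ) (n : ℕ) :
    (W.baseChange (κ.layer n)).selmerCorank p ≤
      lambdaInvariant p (D.X ⧸ (Ideal.span {((1 + PowerSeries.X : PowerSeries ℤ_[p]) ^ (p ^ n) - 1 : IwasawaAlgebra p)} •
        ⊤ : Submodule (IwasawaAlgebra p) D.X)) ∧
    (Finite (W.KerG κ n) → (W.baseChange (κ.layer n)).selmerCorank p =
      lambdaInvariant p (D.X ⧸ (Ideal.span {((1 + PowerSeries.X : PowerSeries ℤ_[p]) ^ (p ^ n) - 1 : IwasawaAlgebra p)} •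
        ⊤ : Submodule (IwasawaAlgebra p) D.X))) := by
  haveI : Module.Finite (IwasawaAlgebra p) D.X := SelmerDualData.module_finite_of_isCyclotomic W κ hκ D hγ
  exact ⟨selmerCorank_layer_le_lambdaInvariant_layerQuotient W κ hγ D n, fun h ↦ by
    haveI := h; exact selmerCorank_layer_eq_lambdaInvariant_layerQuotient_of_finite_kerG W κ hγ D n⟩

end Control

end Summit.BirchSwinnertonDyer.BirchSwinnertonDyer.Theorems.AlignedTransportAtTwoSelmerLayerControl

end
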